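import Literature.Analysis.FluidPDE.ParasiticSlabFlow
import HarnessLib

/-!
# A kinematic apex-class witness: the Type-I function classes with `𝐈 < ∞` are consistent

Analysis/FluidPDE proofs-layer file (theorems + four data definitions in the sub-namespace
`ParabolicBump`, no new `Prop` facts) over the accepted `HasWeakSpatialGradientOn`
(`SuitableWeak.lean`), `HasTypeITimeDecay` / `HasTypeIDecay` (`SelfSimilar.lean`; Koch–Nadirashvili–
Seregin–Šverák 2009, (1.4)/(1.6)) and Albritton–Barker's `typeIBound` = `𝐈(ω)`, `cknAEss` = `A`,
`IsBackwardSingularPoint` (`LocalTypeI.lean`; Albritton–Barker 2019, §1), companion of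
`ParasiticSlabFlow.lean` (the parasitic flow: a genuine Navier–Stokes solution with the rate, a
fully singular final slice and `𝐈 = ∞`).

Here the opposite corner is exhibited: the EXPLICIT field
`u(t, x) = χ(‖x‖²/(−t))/√(−t) · e₀` (`ParabolicBump.apexVelocity`; `χ` a smooth cutoff, `= 1` on
`s ≤ 1`, `= 0` on `s ≥ 2`), a self-similar bump filling the backward paraboloid `‖x‖ ≲ √(−t)`,
is PROVED to satisfy simultaneously

* smoothness on the open slab `(-∞,0) × ℝ³` and a weak spatial gradient there
  (`ParabolicBump.apex_hasWeakSpatialGradientOn`);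
* the Type-I rate `‖u‖ ≤ 1/√(−t)` (KNSS (1.4)) and the space–time (apex) bound
  `‖u‖ ≤ 3/(‖x‖ + √(−t))` (KNSS (1.6)) (`apex_hasTypeITimeDecay`, `apex_hasTypeIDecay`);
* a backward-singular space–time origin in Albritton–Barker's sense (`ess sup_{Q(0,r)} |u| = ∞`
  for every `r > 0`, `apex_isBackwardSingularPoint`);
* **`𝐈(ℝ³ × ℝ₋) < ∞`** with pressure `0` (`typeIBound_apex_lt_top`): on EVERY parabolic ball
  `Q(z, r)` of the lower half-space `A ≤ 8|B₁|`, `C ≤ 8|B₁|`, `D = 0`, `E ≤ 768 L²|B₁|`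
  (`L = sup |χ'|`), by the slice bounds `|u(t)|² ≤ (−t)⁻¹ 𝟙_{B(0,2√(−t))}`,
  `|∇u(t)|²_F ≤ 48L²(−t)⁻² 𝟙_{B(0,2√(−t))}`, `|B(0,2√(−t)) ∩ B(x₀,r)| ≤ |B₁| min(r³, 8(−t)^{3/2})`
  and `∫_{t'-ρ²}^{t'} (−s)^{−1/2} ds ≤ 2ρ`.

So every conjunct of the "apex Type-I profile" class used by the Type-I routes of the
Navier–Stokes summit (suitable weak solution on the slab ∧ weak gradient ∧ `𝐈 < ∞` ∧ apex bound ∧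
singular origin) EXCEPT the Navier–Stokes equations is jointly satisfiable
(`apexClass_kinematically_inhabited`): statements such as "no apex Type-I profile exists" are
genuinely dynamical (false with the equations dropped), and the tree's renderings of `𝐈`, of the
apex bound and of backward singular points carry no hidden junk at the apex. It is NOT claimed
that `u` solves any equation (it is not divergence-free).

Used by the disprover of route item `ApexLocalisation` (stmt-NavierStokesRegularity-11719, route
RellichScar) to certify that the Navier–Stokes hypothesis of the antecedent is load-bearing and
that the route target is not a kinematic triviality.

## References

* G. Koch, N. Nadirashvili, G. Seregin, V. Šverák, *Liouville theorems for the Navier–Stokes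
  equations and applications*, Acta Math. 203 (2009) 83–105, §1, (1.4), (1.6) [KNSS2009].
* D. Albritton, T. Barker, *On local Type I singularities of the Navier–Stokes equations and
  Liouville theorems*, J. Math. Fluid Mech. 21 (2019), §1 (`A, C, D, E`, `𝐈(ω)`, singular
  points) [AlbrittonBarker2019].
-/

noncomputable section

open MeasureTheory TopologicalSpace Set Function Filter Topology Metric
open scoped InnerProductSpace RealInnerProductSpace ENNReal NNReal

namespace Literature.Analysis.FluidPDE

namespace ParabolicBump

/-- Local notation for physical space `ℝ³ = EuclideanSpace ℝ (Fin 3)`. -/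
local notation "ℝ³" => EuclideanSpace ℝ (Fin 3)

/-- Local notation for the open backward slab `(-∞, 0) × ℝ³` (time first). -/
local notation "𝕊" => slab (EuclideanSpace ℝ (Fin 3)) (Set.Iio (0 : ℝ)) isOpen_Iio

/-! ### The cutoff -/

/-- `χ(s) = smoothTransition (2 - s)`: smooth, `= 1` for `s ≤ 1`, `= 0` for `s ≥ 2`, in `[0,1]`. [folklore] -/
def cutoff (s : ℝ) : ℝ := Real.smoothTransition (2 - s)

/-- `χ ≥ 0`. [folklore] -/
theorem cutoff_nonneg (s : ℝ) : 0 ≤ cutoff s := Real.smoothTransition.nonneg _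

/-- `χ ≤ 1`. [folklore] -/
theorem cutoff_le_one (s : ℝ) : cutoff s ≤ 1 := Real.smoothTransition.le_one _

/-- `χ = 1` on `s ≤ 1`. [folklore] -/
theorem cutoff_of_le_one {s : ℝ} (h : s ≤ 1) : cutoff s = 1 :=
  Real.smoothTransition.one_of_one_le (by linarith)

/-- `χ = 0` on `s ≥ 2`. [folklore] -/
theorem cutoff_of_two_le {s : ℝ} (h : 2 ≤ s) : cutoff s = 0 :=
  Real.smoothTransition.zero_of_nonpos (by linarith)

/-- `χ` is smooth. [folklore] -/
theorem contDiff_cutoff {n : ℕ∞} : ContDiff ℝ n cutoff :=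
  show ContDiff ℝ n (fun s => Real.smoothTransition (2 - s)) from
    Real.smoothTransition.contDiff.comp (contDiff_const.sub contDiff_id)

/-- `χ` is differentiable. [folklore] -/
theorem differentiable_cutoff : Differentiable ℝ cutoff :=
  (contDiff_cutoff (n := 1)).differentiable (by simp)

/-- `χ` has derivative `χ'`. [folklore] -/
theorem hasDerivAt_cutoff (s : ℝ) : HasDerivAt cutoff (deriv cutoff s) s :=
  (differentiable_cutoff s).hasDerivAt

/-- `χ' = 0` off `[1, 2]`. [folklore] -/
theorem deriv_cutoff_eq_zero_of_lt {s : ℝ} (h : s < 1 ∨ 2 < s) : deriv cutoff s = 0 := by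
  rcases h with h | h
  · have hev : cutoff =ᶠ[𝓝 s] fun _ => (1 : ℝ) := by
      filter_upwards [Iio_mem_nhds h] with y hy
      exact cutoff_of_le_one (le_of_lt hy)
    rw [hev.deriv_eq, deriv_const]
  · have hev : cutoff =ᶠ[𝓝 s] fun _ => (0 : ℝ) := by
      filter_upwards [Ioi_mem_nhds h] with y hy
      exact cutoff_of_two_le (le_of_lt hy)
    rw [hev.deriv_eq, deriv_const]

/-- A global bound `L` for `|χ'|`. [folklore] -/
theorem exists_bound_deriv_cutoff : ∃ L : ℝ, 0 ≤ L ∧ ∀ s, |deriv cutoff s| ≤ L := by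
  have hcont : Continuous (deriv cutoff) := (contDiff_cutoff (n := 1)).continuous_deriv (by simp)
  obtain ⟨L, hL⟩ := isCompact_Icc.exists_bound_of_continuousOn (hcont.continuousOn (s := Icc 1 2))
  refine ⟨max L 0, le_max_right _ _, fun s => ?_⟩
  by_cases hs : s ∈ Icc (1 : ℝ) 2
  · exact ((Real.norm_eq_abs _).symm.le.trans (hL s hs)).trans (le_max_left _ _)
  · rw [mem_Icc, not_and_or, not_le, not_le] at hs
    rw [deriv_cutoff_eq_zero_of_lt hs, abs_zero]
    exact le_max_right _ _

/-! ### The witness -/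

/-- Amplitude `a(t,x) = χ(‖x‖²/(−t)) / √(−t)` (zero for `t ≥ 0` by `√(−t) = 0`). [folklore] -/
def apexAmp (t : ℝ) (x : ℝ³) : ℝ := cutoff (‖x‖ ^ 2 / (-t)) / Real.sqrt (-t)

/-- The kinematic apex field `u(t,x) = a(t,x) e₀`. [folklore] -/
def apexVelocity : ℝ → ℝ³ → ℝ³ := fun t x => apexAmp t x • parasiticDir

/-- Its classical spatial gradient. [folklore] -/
def apexGradient : ℝ → ℝ³ → ℝ³ →L[ℝ] ℝ³ := fun t x => fderiv ℝ (apexVelocity t) x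

/-- `a ≥ 0`. [folklore] -/
theorem apexAmp_nonneg (t : ℝ) (x : ℝ³) : 0 ≤ apexAmp t x :=
  div_nonneg (cutoff_nonneg _) (Real.sqrt_nonneg _)

/-- `a(t,x) ≤ 1/√(−t)` (the Type-I rate, KNSS 2009 (1.4)). [cite: KNSS2009, (1.4)] -/
theorem apexAmp_le (t : ℝ) (x : ℝ³) : apexAmp t x ≤ 1 / Real.sqrt (-t) :=
  div_le_div_of_nonneg_right (cutoff_le_one _) (Real.sqrt_nonneg _)

/-- `a(t,·)` vanishes where `‖x‖² ≥ 2(−t)`. [folklore] -/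
theorem apexAmp_eq_zero_of {t : ℝ} (ht : t < 0) {x : ℝ³} (hx : 2 * (-t) ≤ ‖x‖ ^ 2) :
    apexAmp t x = 0 := by
  unfold apexAmp
  rw [cutoff_of_two_le, zero_div]
  rwa [le_div_iff₀ (by linarith)]

/-- `a(t,x) = 1/√(−t)` where `‖x‖² ≤ −t`. [folklore] -/
theorem apexAmp_eq_of {t : ℝ} (ht : t < 0) {x : ℝ³} (hx : ‖x‖ ^ 2 ≤ -t) :
    apexAmp t x = 1 / Real.sqrt (-t) := by
  unfold apexAmp
  rw [cutoff_of_le_one]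
  rwa [div_le_one (by linarith)]

/-- `‖u(t,x)‖ = a(t,x)`. [folklore] -/
theorem norm_apexVelocity (t : ℝ) (x : ℝ³) : ‖apexVelocity t x‖ = apexAmp t x := by
  show ‖apexAmp t x • parasiticDir‖ = _
  rw [norm_smul, norm_parasiticDir, mul_one, Real.norm_of_nonneg (apexAmp_nonneg t x)]

/-- Off the paraboloid `‖x‖ < 2√(−t)` the field vanishes. [folklore] -/
theorem apexVelocity_eq_zero_of {t : ℝ} (ht : t < 0) {x : ℝ³} (hx : 2 * Real.sqrt (-t) ≤ ‖x‖) :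
    apexVelocity t x = 0 := by
  have h4 : 2 * (-t) ≤ ‖x‖ ^ 2 := by
    have hs := Real.sq_sqrt (show 0 ≤ -t by linarith)
    nlinarith [Real.sqrt_nonneg (-t)]
  show apexAmp t x • parasiticDir = 0
  rw [apexAmp_eq_zero_of ht h4, zero_smul]

/-! ### Smoothness on the open slab, weak gradient -/

/-- The amplitude is smooth on the open slab `t < 0`. [folklore] -/
theorem contDiffOn_apexAmp {n : ℕ∞} : ContDiffOn ℝ n (uncurry apexAmp) (Iio 0 ×ˢ univ) := by
  have hne : ∀ z ∈ Iio (0 : ℝ) ×ˢ (univ : Set ℝ³), -z.1 ≠ 0 := fun z hz => by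
    have := hz.1
    simp only [mem_Iio] at this
    linarith
  have h1 : ContDiffOn ℝ n (fun z : ℝ × ℝ³ => ‖z.2‖ ^ 2 / (-z.1)) (Iio 0 ×ˢ univ) :=
    ((contDiff_norm_sq ℝ).comp contDiff_snd).contDiffOn.div contDiffOn_fst.neg hne
  have h2 : ContDiffOn ℝ n (fun z : ℝ × ℝ³ => cutoff (‖z.2‖ ^ 2 / (-z.1))) (Iio 0 ×ˢ univ) :=
    contDiff_cutoff.comp_contDiffOn h1
  have h3 : ContDiffOn ℝ n (fun z : ℝ × ℝ³ => Real.sqrt (-z.1)) (Iio 0 ×ˢ univ) := fun z hz =>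
    ((Real.contDiffAt_sqrt (hne z hz)).comp z contDiffAt_fst.neg).contDiffWithinAt
  have hs : ∀ z ∈ Iio (0 : ℝ) ×ˢ (univ : Set ℝ³), Real.sqrt (-z.1) ≠ 0 := fun z hz =>
    (Real.sqrt_pos.2 (by have := hz.1; simp only [mem_Iio] at this; linarith)).ne'
  exact h2.div h3 hs

/-- The field is smooth on the open slab `t < 0`. [folklore] -/
theorem contDiffOn_apexVelocity {n : ℕ∞} :
    ContDiffOn ℝ n (uncurry apexVelocity) (Iio 0 ×ˢ univ) :=
  contDiffOn_apexAmp.smul contDiffOn_const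

/-- The classical gradient is a weak spatial gradient on the slab. [folklore] -/
theorem apex_hasWeakSpatialGradientOn : HasWeakSpatialGradientOn 𝕊 apexVelocity apexGradient :=
  hasWeakSpatialGradientOn_of_contDiffOn (S := Iio 0) isOpen_Iio (by simp)
    (contDiffOn_apexVelocity (n := 1))

/-! ### The two Type-I bounds and the singular origin -/

/-- The field has the Type-I RATE with constant `1` (KNSS 2009 (1.4)). [cite: KNSS2009, (1.4)] -/
theorem apex_hasTypeITimeDecay : HasTypeITimeDecay 1 apexVelocity := fun t _ x => by
  rw [norm_apexVelocity]
  exact apexAmp_le t x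

/-- The field has the space–time Type-I (apex) bound with constant `3` (KNSS 2009 (1.6)): on its support `‖x‖ + √(−t) ≤ 3√(−t)`. [cite: KNSS2009, (1.6)] -/
theorem apex_hasTypeIDecay : HasTypeIDecay 3 apexVelocity := by
  intro t ht x
  have hs : 0 < Real.sqrt (-t) := Real.sqrt_pos.2 (by linarith)
  by_cases hx : 2 * Real.sqrt (-t) ≤ ‖x‖
  · rw [apexVelocity_eq_zero_of ht hx, norm_zero]
    positivity
  · push Not at hx
    rw [norm_apexVelocity]
    calc apexAmp t x ≤ 1 / Real.sqrt (-t) := apexAmp_le t x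
      _ ≤ 3 / (‖x‖ + Real.sqrt (-t)) := by
          rw [div_le_div_iff₀ hs (by positivity)]
          nlinarith [norm_nonneg x]

/-- The field is backward-singular at the space–time origin (Albritton–Barker 2019 §1): `‖u‖ = 1/√(−t) > N` on `(−2ρ², −ρ²) × B_ρ ⊆ Q(0,r)`, a set of positive measure. [cite: AlbrittonBarker2019, §1] -/
theorem apex_isBackwardSingularPoint : IsBackwardSingularPoint apexVelocity 0 := by
  intro r hr
  rw [eLpNorm_exponent_top]
  show essSup (fun z => ‖uncurry apexVelocity z‖ₑ) _ = ⊤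
  apply essSup_eq_top_of_forall_exists_lt
  intro N
  set ρ : ℝ := min (r / 2) (1 / (2 * ((N : ℝ) + 1))) with hρ
  have hN1 : (0 : ℝ) < (N : ℝ) + 1 := by positivity
  have hρpos : 0 < ρ := lt_min (by positivity) (by positivity)
  have hρr : ρ ≤ r / 2 := min_le_left _ _
  have hρN : ρ ≤ 1 / (2 * ((N : ℝ) + 1)) := min_le_right _ _
  have hsub : Ioo (-(2 * ρ ^ 2)) (-(ρ ^ 2)) ×ˢ ball (0 : ℝ³) ρ ⊆ parabolicCylinder r (0 : ℝ × ℝ³) := by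
    rintro ⟨t, x⟩ ⟨⟨ht1, ht2⟩, hx⟩
    rw [mem_parabolicCylinder]
    refine ⟨⟨?_, ?_⟩, ?_⟩
    · simp only [Prod.fst_zero]
      nlinarith
    · simp only [Prod.fst_zero]
      nlinarith
    · have : dist x (0 : ℝ³) < ρ := mem_ball.1 hx
      simp only [Prod.snd_zero]
      linarith
  refine ⟨Ioo (-(2 * ρ ^ 2)) (-(ρ ^ 2)) ×ˢ ball 0 ρ, ?_, ?_⟩
  · rw [Measure.restrict_apply (measurableSet_Ioo.prod measurableSet_ball), inter_eq_left.2 hsub,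
      Measure.volume_eq_prod, Measure.prod_prod]
    refine mul_ne_zero ?_ (measure_ball_pos volume (0 : ℝ³) hρpos).ne'
    rw [Real.volume_Ioo, ne_eq, ENNReal.ofReal_eq_zero, not_le]
    nlinarith
  · rintro ⟨t, x⟩ ⟨⟨ht1, ht2⟩, hx⟩
    simp only [uncurry_apply_pair]
    have ht : t < 0 := by nlinarith
    have hxρ : ‖x‖ < ρ := by simpa using hx
    have hxt : ‖x‖ ^ 2 ≤ -t := by nlinarith [norm_nonneg x]
    rw [← ofReal_norm, norm_apexVelocity, apexAmp_eq_of ht hxt,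
      show ((N : ℝ≥0) : ℝ≥0∞) = ENNReal.ofReal (N : ℝ) by simp]
    have hspos : 0 < Real.sqrt (-t) := Real.sqrt_pos.2 (by linarith)
    rw [ENNReal.ofReal_lt_ofReal_iff (by positivity), lt_div_iff₀ hspos]
    have h1 : Real.sqrt (-t) < 1 / ((N : ℝ) + 1) := by
      rw [Real.sqrt_lt' (by positivity)]
      have hρ2 : ρ ^ 2 ≤ (1 / (2 * ((N : ℝ) + 1))) ^ 2 := pow_le_pow_left₀ hρpos.le hρN 2
      have e : (1 / (2 * ((N : ℝ) + 1))) ^ 2 = (1 / ((N : ℝ) + 1)) ^ 2 / 4 := by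
        field_simp
        ring
      rw [e] at hρ2
      have hpos : 0 ≤ (1 / ((N : ℝ) + 1)) ^ 2 := sq_nonneg _
      nlinarith
    calc (N : ℝ) * Real.sqrt (-t) ≤ ((N : ℝ) + 1) * Real.sqrt (-t) := by nlinarith [hspos.le]
      _ < ((N : ℝ) + 1) * (1 / ((N : ℝ) + 1)) := mul_lt_mul_of_pos_left h1 hN1
      _ = 1 := by field_simp


/-! ### `𝐈 < ⊤` for the witness (pressure `0`) -/

/-- Volume of balls in `ℝ³` through the unit ball. [folklore] -/
theorem volume_ball_three (x : ℝ³) {r : ℝ} (hr : 0 < r) :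
    volume (ball x r) = ENNReal.ofReal (r ^ 3) * volume (ball (0 : ℝ³) 1) := by
  rw [Measure.addHaar_ball_of_pos volume x hr, finrank_euclideanSpace_fin]

/-- Times of an admissible cylinder are negative. [folklore] -/
theorem neg_of_mem_time {r : ℝ} (hr : 0 < r) {z : ℝ × ℝ³}
    (hz : parabolicCylinder r z ⊆ Iio (0 : ℝ) ×ˢ (univ : Set ℝ³)) {t : ℝ}
    (ht : t ∈ Ioo (z.1 - r ^ 2) z.1) : t < 0 := by
  have hmem : (t, z.2) ∈ parabolicCylinder r z := by
    rw [mem_parabolicCylinder]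
    exact ⟨ht, by simpa using hr⟩
  exact (hz hmem).1

/-- Hence the top time of an admissible cylinder is `≤ 0`. [folklore] -/
theorem fst_nonpos_of_subset {r : ℝ} (hr : 0 < r) {z : ℝ × ℝ³}
    (hz : parabolicCylinder r z ⊆ Iio (0 : ℝ) ×ˢ (univ : Set ℝ³)) : z.1 ≤ 0 := by
  by_contra h
  push Not at h
  set m : ℝ := min (r ^ 2) z.1 with hm
  have hm0 : 0 < m := lt_min (by positivity) h
  have hmr : m ≤ r ^ 2 := min_le_left _ _
  have hmz : m ≤ z.1 := min_le_right _ _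
  have ht : z.1 - m / 2 ∈ Ioo (z.1 - r ^ 2) z.1 := ⟨by linarith, by linarith⟩
  have := neg_of_mem_time hr hz ht
  linarith

/-- Slice bound for `|u|²`: supported in `B(0, 2√(−t))`, bounded by `1/(−t)`. [folklore] -/
theorem enorm_sq_apex_le {t : ℝ} (ht : t < 0) (x : ℝ³) :
    ‖apexVelocity t x‖ₑ ^ 2 ≤
      (ball (0 : ℝ³) (2 * Real.sqrt (-t))).indicator (fun _ => ENNReal.ofReal (1 / (-t))) x := by
  by_cases hx : x ∈ ball (0 : ℝ³) (2 * Real.sqrt (-t))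
  · rw [indicator_of_mem hx, ← ofReal_norm, ← ENNReal.ofReal_pow (norm_nonneg _), norm_apexVelocity]
    refine ENNReal.ofReal_le_ofReal ?_
    calc apexAmp t x ^ 2 ≤ (1 / Real.sqrt (-t)) ^ 2 :=
          pow_le_pow_left₀ (apexAmp_nonneg t x) (apexAmp_le t x) 2
      _ = 1 / (-t) := by rw [div_pow, one_pow, Real.sq_sqrt (by linarith)]
  · rw [indicator_of_notMem hx]
    have hx' : 2 * Real.sqrt (-t) ≤ ‖x‖ := by
      simpa [mem_ball, dist_zero_right] using hx
    rw [apexVelocity_eq_zero_of ht hx']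
    simp

/-- Slice bound for `|u|³`. [folklore] -/
theorem enorm_cube_apex_le {t : ℝ} (ht : t < 0) (x : ℝ³) :
    ‖apexVelocity t x‖ₑ ^ (3 : ℕ) ≤
      (ball (0 : ℝ³) (2 * Real.sqrt (-t))).indicator
        (fun _ => ENNReal.ofReal ((1 / Real.sqrt (-t)) ^ 3)) x := by
  by_cases hx : x ∈ ball (0 : ℝ³) (2 * Real.sqrt (-t))
  · rw [indicator_of_mem hx, ← ofReal_norm, ← ENNReal.ofReal_pow (norm_nonneg _), norm_apexVelocity]
    exact ENNReal.ofReal_le_ofReal (pow_le_pow_left₀ (apexAmp_nonneg t x) (apexAmp_le t x) 3)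
  · rw [indicator_of_notMem hx]
    have hx' : 2 * Real.sqrt (-t) ≤ ‖x‖ := by
      simpa [mem_ball, dist_zero_right] using hx
    rw [apexVelocity_eq_zero_of ht hx']
    simp

/-- `∫_{B(x₀,r)} 𝟙_S c = c |S ∩ B(x₀,r)|`. [folklore] -/
theorem lintegral_ball_indicator_const (x₀ : ℝ³) (r : ℝ) {S : Set ℝ³} (hS : MeasurableSet S)
    (c : ℝ≥0∞) : ∫⁻ x in ball x₀ r, S.indicator (fun _ => c) x = c * volume (S ∩ ball x₀ r) := by
  rw [lintegral_indicator hS, setLIntegral_const, Measure.restrict_apply hS]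

/-- `(2√(−t))³ = 8 (−t) √(−t)`. [folklore] -/
theorem two_sqrt_cube {t : ℝ} (ht : t < 0) :
    (2 * Real.sqrt (-t)) ^ 3 = 8 * (-t) * Real.sqrt (-t) := by
  have hs : Real.sqrt (-t) ^ 2 = -t := Real.sq_sqrt (by linarith)
  calc (2 * Real.sqrt (-t)) ^ 3 = 8 * Real.sqrt (-t) ^ 2 * Real.sqrt (-t) := by ring
    _ = 8 * (-t) * Real.sqrt (-t) := by rw [hs]

/-- The scaled slice energy of the witness is bounded: `r⁻¹ ∫_{B(x₀,r)} |u(t)|² ≤ 8|B₁|`. [folklore] -/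
theorem sliceA_le {t r : ℝ} (ht : t < 0) (hr : 0 < r) (x₀ : ℝ³) :
    (ENNReal.ofReal r)⁻¹ * ∫⁻ x in ball x₀ r, ‖apexVelocity t x‖ₑ ^ 2 ≤
      8 * volume (ball (0 : ℝ³) 1) := by
  set V₁ := volume (ball (0 : ℝ³) 1) with hV₁
  have hs : 0 < Real.sqrt (-t) := Real.sqrt_pos.2 (by linarith)
  have hnt : 0 < -t := by linarith
  have ht0 : t ≠ 0 := ht.ne
  have hs0 : Real.sqrt (-t) ≠ 0 := hs.ne'
  have hI : ∫⁻ x in ball x₀ r, ‖apexVelocity t x‖ₑ ^ 2 ≤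
      ENNReal.ofReal (1 / (-t)) * volume (ball (0 : ℝ³) (2 * Real.sqrt (-t)) ∩ ball x₀ r) := by
    calc ∫⁻ x in ball x₀ r, ‖apexVelocity t x‖ₑ ^ 2
        ≤ ∫⁻ x in ball x₀ r, (ball (0 : ℝ³) (2 * Real.sqrt (-t))).indicator
            (fun _ => ENNReal.ofReal (1 / (-t))) x := lintegral_mono fun x => enorm_sq_apex_le ht x
      _ = _ := lintegral_ball_indicator_const x₀ r measurableSet_ball _
  have h8 : ENNReal.ofReal 8 = 8 := by norm_num
  by_cases hcase : r ^ 2 ≤ -t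
  · calc (ENNReal.ofReal r)⁻¹ * ∫⁻ x in ball x₀ r, ‖apexVelocity t x‖ₑ ^ 2
        ≤ (ENNReal.ofReal r)⁻¹ * (ENNReal.ofReal (1 / (-t)) * volume (ball x₀ r)) :=
          mul_le_mul' le_rfl (hI.trans (mul_le_mul' le_rfl (measure_mono inter_subset_right)))
      _ = ENNReal.ofReal (r⁻¹ * (1 / (-t)) * r ^ 3) * V₁ := by
          rw [volume_ball_three x₀ hr, ← ENNReal.ofReal_inv_of_pos hr, ← mul_assoc, ← mul_assoc,
            ← ENNReal.ofReal_mul (by positivity), ← ENNReal.ofReal_mul (by positivity)]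
      _ ≤ ENNReal.ofReal 8 * V₁ := by
          refine mul_le_mul' (ENNReal.ofReal_le_ofReal ?_) le_rfl
          have e : r⁻¹ * (1 / (-t)) * r ^ 3 = r ^ 2 / (-t) := by
            field_simp
          rw [e]
          have := (div_le_one hnt).2 hcase
          linarith
      _ = 8 * V₁ := by rw [h8]
  · push Not at hcase
    have hsr : Real.sqrt (-t) < r := (Real.sqrt_lt' hr).2 hcase
    calc (ENNReal.ofReal r)⁻¹ * ∫⁻ x in ball x₀ r, ‖apexVelocity t x‖ₑ ^ 2
        ≤ (ENNReal.ofReal r)⁻¹ *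
            (ENNReal.ofReal (1 / (-t)) * volume (ball (0 : ℝ³) (2 * Real.sqrt (-t)))) :=
          mul_le_mul' le_rfl (hI.trans (mul_le_mul' le_rfl (measure_mono inter_subset_left)))
      _ = ENNReal.ofReal (r⁻¹ * (1 / (-t)) * (2 * Real.sqrt (-t)) ^ 3) * V₁ := by
          rw [volume_ball_three 0 (by positivity), ← ENNReal.ofReal_inv_of_pos hr, ← mul_assoc,
            ← mul_assoc, ← ENNReal.ofReal_mul (by positivity), ← ENNReal.ofReal_mul (by positivity)]
      _ ≤ ENNReal.ofReal 8 * V₁ := by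
          refine mul_le_mul' (ENNReal.ofReal_le_ofReal ?_) le_rfl
          rw [two_sqrt_cube ht]
          have e : r⁻¹ * (1 / (-t)) * (8 * (-t) * Real.sqrt (-t)) = 8 * (Real.sqrt (-t) / r) := by
            field_simp
          rw [e]
          have : Real.sqrt (-t) / r ≤ 1 := (div_le_one hr).2 hsr.le
          linarith
      _ = 8 * V₁ := by rw [h8]

/-- `A(Q(z,r)) ≤ 8|B₁|` for every admissible cylinder. [cite: AlbrittonBarker2019, §1] -/
theorem cknAEss_apex_le {r : ℝ} (hr : 0 < r) {z : ℝ × ℝ³}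
    (hz : parabolicCylinder r z ⊆ Iio (0 : ℝ) ×ˢ (univ : Set ℝ³)) :
    cknAEss r z apexVelocity ≤ 8 * volume (ball (0 : ℝ³) 1) := by
  unfold cknAEss
  refine essSup_le_of_ae_le _ ?_
  filter_upwards [ae_restrict_mem measurableSet_Ioo] with t ht
  exact sliceA_le (neg_of_mem_time hr hz ht) hr z.2

/-- Slice bound for the cubic quantity: `∫_{B(x₀,r)} |u(t)|³ ≤ 8|B₁|`. [folklore] -/
theorem sliceC_le {t : ℝ} (ht : t < 0) (x₀ : ℝ³) (r : ℝ) :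
    ∫⁻ x in ball x₀ r, ‖apexVelocity t x‖ₑ ^ (3 : ℕ) ≤ 8 * volume (ball (0 : ℝ³) 1) := by
  set V₁ := volume (ball (0 : ℝ³) 1) with hV₁
  have hs : 0 < Real.sqrt (-t) := Real.sqrt_pos.2 (by linarith)
  have h8 : ENNReal.ofReal 8 = 8 := by norm_num
  calc ∫⁻ x in ball x₀ r, ‖apexVelocity t x‖ₑ ^ (3 : ℕ)
      ≤ ∫⁻ x in ball x₀ r, (ball (0 : ℝ³) (2 * Real.sqrt (-t))).indicator
          (fun _ => ENNReal.ofReal ((1 / Real.sqrt (-t)) ^ 3)) x :=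
        lintegral_mono fun x => enorm_cube_apex_le ht x
    _ = ENNReal.ofReal ((1 / Real.sqrt (-t)) ^ 3) *
          volume (ball (0 : ℝ³) (2 * Real.sqrt (-t)) ∩ ball x₀ r) :=
        lintegral_ball_indicator_const x₀ r measurableSet_ball _
    _ ≤ ENNReal.ofReal ((1 / Real.sqrt (-t)) ^ 3) * volume (ball (0 : ℝ³) (2 * Real.sqrt (-t))) :=
        mul_le_mul' le_rfl (measure_mono inter_subset_left)
    _ = ENNReal.ofReal ((1 / Real.sqrt (-t)) ^ 3 * (2 * Real.sqrt (-t)) ^ 3) * V₁ := by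
        rw [volume_ball_three 0 (by positivity), ← mul_assoc, ← ENNReal.ofReal_mul (by positivity)]
    _ = 8 * V₁ := by
        rw [← mul_pow, show 1 / Real.sqrt (-t) * (2 * Real.sqrt (-t)) = 2 by field_simp]
        norm_num

/-- The product structure of the measure restricted to a parabolic cylinder. [folklore] -/
theorem volume_restrict_parabolicCylinder' (r : ℝ) (z : ℝ × ℝ³) :
    (volume : Measure (ℝ × ℝ³)).restrict (parabolicCylinder r z) =
      (volume.restrict (Ioo (z.1 - r ^ 2) z.1)).prod (volume.restrict (ball z.2 r)) := by
  rw [Measure.prod_restrict, ← Measure.volume_eq_prod]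
  rfl

/-- Tonelli over a parabolic cylinder with a slice-wise bound. [folklore] -/
theorem lintegral_cylinder_le_of_slice {r : ℝ} {z : ℝ × ℝ³} {g : ℝ × ℝ³ → ℝ≥0∞}
    (hg : AEMeasurable g (volume.restrict (parabolicCylinder r z))) {h : ℝ → ℝ≥0∞}
    (hle : ∀ᵐ t ∂(volume.restrict (Ioo (z.1 - r ^ 2) z.1)), ∫⁻ x in ball z.2 r, g (t, x) ≤ h t) :
    ∫⁻ w in parabolicCylinder r z, g w ≤ ∫⁻ t in Ioo (z.1 - r ^ 2) z.1, h t := by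
  rw [volume_restrict_parabolicCylinder'] at hg ⊢
  rw [lintegral_prod _ hg]
  exact lintegral_mono_ae hle

/-- The witness is a.e.-measurable on the slab (it is continuous there). [folklore] -/
theorem aemeasurable_apexVelocity_slab :
    AEMeasurable (uncurry apexVelocity) (volume.restrict (Iio (0 : ℝ) ×ˢ (univ : Set ℝ³))) :=
  (contDiffOn_apexVelocity (n := 0)).continuousOn.aemeasurable (measurableSet_Iio.prod MeasurableSet.univ)

/-- `C(Q(z,r)) ≤ 8|B₁|` for every admissible cylinder. [folklore] -/
theorem cknC_apex_le {r : ℝ} (hr : 0 < r) {z : ℝ × ℝ³}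
    (hz : parabolicCylinder r z ⊆ Iio (0 : ℝ) ×ˢ (univ : Set ℝ³)) :
    cknC r z apexVelocity ≤ 8 * volume (ball (0 : ℝ³) 1) := by
  set V₁ := volume (ball (0 : ℝ³) 1) with hV₁
  unfold cknC
  have hmeas : AEMeasurable (fun q : ℝ × ℝ³ => ‖apexVelocity q.1 q.2‖ₑ ^ (3 : ℕ))
      (volume.restrict (parabolicCylinder r z)) :=
    ((aemeasurable_apexVelocity_slab.mono_measure (Measure.restrict_mono hz le_rfl)).enorm.pow_const _)
  have h1 : ∫⁻ q in parabolicCylinder r z, ‖apexVelocity q.1 q.2‖ₑ ^ (3 : ℕ) ≤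
      ∫⁻ _ in Ioo (z.1 - r ^ 2) z.1, 8 * V₁ :=
    lintegral_cylinder_le_of_slice hmeas (by
      filter_upwards [ae_restrict_mem measurableSet_Ioo] with t ht
      exact sliceC_le (neg_of_mem_time hr hz ht) z.2 r)
  rw [setLIntegral_const, Real.volume_Ioo, show z.1 - (z.1 - r ^ 2) = r ^ 2 by ring,
    ENNReal.ofReal_pow hr.le] at h1
  have hX0 : ENNReal.ofReal r ^ 2 ≠ 0 := pow_ne_zero _ (ENNReal.ofReal_pos.2 hr).ne'
  have hXt : ENNReal.ofReal r ^ 2 ≠ ⊤ := ENNReal.pow_ne_top ENNReal.ofReal_ne_top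
  calc (ENNReal.ofReal r ^ 2)⁻¹ * ∫⁻ q in parabolicCylinder r z, ‖apexVelocity q.1 q.2‖ₑ ^ (3 : ℕ)
      ≤ (ENNReal.ofReal r ^ 2)⁻¹ * (8 * V₁ * ENNReal.ofReal r ^ 2) := mul_le_mul' le_rfl h1
    _ = 8 * V₁ := by
        rw [mul_comm (8 * V₁) _, ← mul_assoc, ENNReal.inv_mul_cancel hX0 hXt, one_mul]

/-! #### The gradient -/

/-- The witness with division rewritten as multiplication. [folklore] -/
theorem apexVelocity_eq (t : ℝ) :
    apexVelocity t = fun y => (cutoff (‖y‖ ^ 2 * (-t)⁻¹) * (Real.sqrt (-t))⁻¹) • parasiticDir := by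
  funext y
  simp only [apexVelocity, apexAmp, div_eq_mul_inv]

/-- The spatial derivative of the witness (chain rule). [folklore] -/
theorem hasFDerivAt_apexVelocity (t : ℝ) (x : ℝ³) :
    HasFDerivAt (apexVelocity t)
      (((Real.sqrt (-t))⁻¹ • (deriv cutoff (‖x‖ ^ 2 * (-t)⁻¹) •
        ((-t)⁻¹ • ((2 : ℝ) • innerSL ℝ x)))).smulRight parasiticDir) x := by
  rw [apexVelocity_eq]
  have h1 : HasFDerivAt (fun y : ℝ³ => ‖y‖ ^ 2) ((2 : ℝ) • innerSL ℝ x) x :=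
    (hasStrictFDerivAt_norm_sq x).hasFDerivAt.congr_fderiv (by rw [two_smul, two_smul])
  have h2 : HasFDerivAt (fun y : ℝ³ => ‖y‖ ^ 2 * (-t)⁻¹) ((-t)⁻¹ • ((2 : ℝ) • innerSL ℝ x)) x :=
    h1.mul_const _
  have h3 : HasFDerivAt (fun y : ℝ³ => cutoff (‖y‖ ^ 2 * (-t)⁻¹))
      (deriv cutoff (‖x‖ ^ 2 * (-t)⁻¹) • ((-t)⁻¹ • ((2 : ℝ) • innerSL ℝ x))) x :=
    (hasDerivAt_cutoff _).comp_hasFDerivAt x h2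
  have h4 : HasFDerivAt (fun y : ℝ³ => cutoff (‖y‖ ^ 2 * (-t)⁻¹) * (Real.sqrt (-t))⁻¹)
      ((Real.sqrt (-t))⁻¹ • (deriv cutoff (‖x‖ ^ 2 * (-t)⁻¹) •
        ((-t)⁻¹ • ((2 : ℝ) • innerSL ℝ x)))) x :=
    h3.mul_const _
  exact h4.smul_const parasiticDir

/-- Norm of the scalar part of the derivative. [folklore] -/
theorem norm_scalarDeriv (t : ℝ) (x : ℝ³) :
    ‖(Real.sqrt (-t))⁻¹ • (deriv cutoff (‖x‖ ^ 2 * (-t)⁻¹) • ((-t)⁻¹ • ((2 : ℝ) • innerSL ℝ x)))‖ =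
      |(Real.sqrt (-t))⁻¹| * (|deriv cutoff (‖x‖ ^ 2 * (-t)⁻¹)| * (|(-t)⁻¹| * (2 * ‖x‖))) := by
  rw [norm_smul, norm_smul, norm_smul, norm_smul, innerSL_apply_norm, Real.norm_eq_abs,
    Real.norm_eq_abs, Real.norm_eq_abs, Real.norm_eq_abs, abs_two]

/-- `|L|²_F ≤ 3 ‖L‖²` on `ℝ³`. [folklore] -/
theorem frobeniusNormSq_le_three_mul_norm_sq' (L : ℝ³ →L[ℝ] ℝ³) :
    frobeniusNormSq L ≤ 3 * ‖L‖ ^ 2 := by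
  unfold frobeniusNormSq
  calc ∑ i, ‖L (stdOrthonormalBasis ℝ ℝ³ i)‖ ^ 2
      ≤ ∑ _i : Fin (Module.finrank ℝ ℝ³), ‖L‖ ^ 2 := by
        refine Finset.sum_le_sum fun i _ => ?_
        have h := L.le_opNorm (stdOrthonormalBasis ℝ ℝ³ i)
        rw [(stdOrthonormalBasis ℝ ℝ³).orthonormal.1 i, mul_one] at h
        exact pow_le_pow_left₀ (norm_nonneg _) h 2
    _ = 3 * ‖L‖ ^ 2 := by
        rw [Finset.sum_const, Finset.card_univ, Fintype.card_fin, finrank_euclideanSpace_fin]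
        simp

/-- Pointwise gradient bound: `|∇u(t,x)|²_F ≤ 48 L²/(−t)² 𝟙_{B(0,2√(−t))}`. [folklore] -/
theorem frobeniusNormSq_apexGradient_le {L : ℝ} (hL0 : 0 ≤ L) (hL : ∀ s, |deriv cutoff s| ≤ L)
    {t : ℝ} (ht : t < 0) (x : ℝ³) :
    ENNReal.ofReal (frobeniusNormSq (apexGradient t x)) ≤
      (ball (0 : ℝ³) (2 * Real.sqrt (-t))).indicator
        (fun _ => ENNReal.ofReal (48 * L ^ 2 / (-t) ^ 2)) x := by
  have hs : 0 < Real.sqrt (-t) := Real.sqrt_pos.2 (by linarith)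
  have hnt : 0 < -t := by linarith
  have hfd : apexGradient t x = ((Real.sqrt (-t))⁻¹ • (deriv cutoff (‖x‖ ^ 2 * (-t)⁻¹) •
      ((-t)⁻¹ • ((2 : ℝ) • innerSL ℝ x)))).smulRight parasiticDir :=
    (hasFDerivAt_apexVelocity t x).fderiv
  by_cases hx : x ∈ ball (0 : ℝ³) (2 * Real.sqrt (-t))
  · rw [indicator_of_mem hx]
    refine ENNReal.ofReal_le_ofReal ?_
    have hxn : ‖x‖ < 2 * Real.sqrt (-t) := by simpa [mem_ball, dist_zero_right] using hx
    have hnorm : ‖apexGradient t x‖ ≤ 4 * L / (-t) := by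
      rw [hfd, ContinuousLinearMap.norm_smulRight_apply, norm_parasiticDir, mul_one, norm_scalarDeriv,
        abs_of_pos (inv_pos.2 hs), abs_of_pos (inv_pos.2 hnt)]
      have hd := hL (‖x‖ ^ 2 * (-t)⁻¹)
      calc (Real.sqrt (-t))⁻¹ * (|deriv cutoff (‖x‖ ^ 2 * (-t)⁻¹)| * ((-t)⁻¹ * (2 * ‖x‖)))
          ≤ (Real.sqrt (-t))⁻¹ * (L * ((-t)⁻¹ * (2 * (2 * Real.sqrt (-t))))) := by
            gcongr
        _ = 4 * L / (-t) := by
            field_simp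
            ring
    calc frobeniusNormSq (apexGradient t x) ≤ 3 * ‖apexGradient t x‖ ^ 2 :=
          frobeniusNormSq_le_three_mul_norm_sq' _
      _ ≤ 3 * (4 * L / (-t)) ^ 2 := by gcongr
      _ = 48 * L ^ 2 / (-t) ^ 2 := by
          field_simp
          ring
  · rw [indicator_of_notMem hx]
    have hxn : 2 * Real.sqrt (-t) ≤ ‖x‖ := by simpa [mem_ball, dist_zero_right] using hx
    have hsarg : 2 < ‖x‖ ^ 2 * (-t)⁻¹ := by
      rw [← div_eq_mul_inv, lt_div_iff₀ hnt]
      have h4 : (2 * Real.sqrt (-t)) ^ 2 ≤ ‖x‖ ^ 2 := pow_le_pow_left₀ (by positivity) hxn 2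
      rw [mul_pow, Real.sq_sqrt hnt.le] at h4
      linarith
    have hd0 : deriv cutoff (‖x‖ ^ 2 * (-t)⁻¹) = 0 := deriv_cutoff_eq_zero_of_lt (Or.inr hsarg)
    have h0 : (0 : ℝ³ →L[ℝ] ℝ).smulRight parasiticDir = 0 := by
      ext v
      simp
    rw [hfd, hd0, zero_smul, smul_zero, h0, frobeniusNormSq_zero, ENNReal.ofReal_zero]

/-- Real bookkeeping for the slice dissipation: `48L²/(−t)² · (2√(−t))³ = 384 L² (−t)^{−1/2}`. [folklore] -/
theorem real_E_identity {t : ℝ} (ht : t < 0) (L : ℝ) :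
    48 * L ^ 2 / (-t) ^ 2 * (2 * Real.sqrt (-t)) ^ 3 = 384 * L ^ 2 * (0 - t) ^ (-(1 / 2) : ℝ) := by
  have hnt : 0 < -t := by linarith
  set s := Real.sqrt (-t) with hsdef
  have hs : 0 < s := Real.sqrt_pos.2 hnt
  have hs0 : s ≠ 0 := hs.ne'
  have hs2 : -t = s ^ 2 := by rw [hsdef, Real.sq_sqrt hnt.le]
  rw [zero_sub, Real.rpow_neg hnt.le, ← Real.sqrt_eq_rpow, ← hsdef, hs2]
  field_simp
  ring

/-- Slice dissipation of the witness: `∫_{B(x₀,r)} |∇u(t)|² ≤ 384 L² (−t)^{−1/2} |B₁|`. [folklore] -/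
theorem sliceE_le {L : ℝ} (hL0 : 0 ≤ L) (hL : ∀ s, |deriv cutoff s| ≤ L) {t : ℝ} (ht : t < 0)
    (x₀ : ℝ³) (r : ℝ) :
    ∫⁻ x in ball x₀ r, ENNReal.ofReal (frobeniusNormSq (apexGradient t x)) ≤
      ENNReal.ofReal (384 * L ^ 2 * (0 - t) ^ (-(1 / 2) : ℝ)) * volume (ball (0 : ℝ³) 1) := by
  set V₁ := volume (ball (0 : ℝ³) 1) with hV₁
  have hs : 0 < Real.sqrt (-t) := Real.sqrt_pos.2 (by linarith)
  calc ∫⁻ x in ball x₀ r, ENNReal.ofReal (frobeniusNormSq (apexGradient t x))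
      ≤ ∫⁻ x in ball x₀ r, (ball (0 : ℝ³) (2 * Real.sqrt (-t))).indicator
          (fun _ => ENNReal.ofReal (48 * L ^ 2 / (-t) ^ 2)) x :=
        lintegral_mono fun x => frobeniusNormSq_apexGradient_le hL0 hL ht x
    _ = ENNReal.ofReal (48 * L ^ 2 / (-t) ^ 2) *
          volume (ball (0 : ℝ³) (2 * Real.sqrt (-t)) ∩ ball x₀ r) :=
        lintegral_ball_indicator_const x₀ r measurableSet_ball _
    _ ≤ ENNReal.ofReal (48 * L ^ 2 / (-t) ^ 2) * volume (ball (0 : ℝ³) (2 * Real.sqrt (-t))) :=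
        mul_le_mul' le_rfl (measure_mono inter_subset_left)
    _ = ENNReal.ofReal (48 * L ^ 2 / (-t) ^ 2 * (2 * Real.sqrt (-t)) ^ 3) * V₁ := by
        rw [volume_ball_three 0 (by positivity), ← mul_assoc, ← ENNReal.ofReal_mul (by positivity)]
    _ = ENNReal.ofReal (384 * L ^ 2 * (0 - t) ^ (-(1 / 2) : ℝ)) * V₁ := by
        rw [real_E_identity ht L]

/-- `∫_{t'-ρ²}^{t'} (−s)^{−1/2} ds ≤ 2ρ` for `t' ≤ 0` (worst case `t' = 0`; subadditivity of `√`). [folklore] -/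
theorem lintegral_invSqrt_time_le {t' ρ : ℝ} (ht : t' ≤ 0) (hρ : 0 < ρ) :
    ∫⁻ s in Ioo (t' - ρ ^ 2) t', ENNReal.ofReal ((0 - s) ^ (-(1 / 2) : ℝ)) ≤
      ENNReal.ofReal (2 * ρ) := by
  have hab : t' - ρ ^ 2 ≤ t' := by nlinarith
  have hint : IntegrableOn (fun s => (0 - s) ^ (-(1 / 2) : ℝ)) (Ioo (t' - ρ ^ 2) t') volume := by
    have h1 : IntervalIntegrable (fun x : ℝ => x ^ (-(1 / 2) : ℝ)) volume (0 - (t' - ρ ^ 2)) (0 - t') :=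
      intervalIntegral.intervalIntegrable_rpow' (by norm_num)
    have h2 := h1.comp_sub_left 0
    simp only [sub_sub_cancel] at h2
    exact ((intervalIntegrable_iff_integrableOn_Ioc_of_le hab).1 h2).mono_set Ioo_subset_Ioc_self
  have hnn : 0 ≤ᵐ[volume.restrict (Ioo (t' - ρ ^ 2) t')] fun s => (0 - s) ^ (-(1 / 2) : ℝ) := by
    filter_upwards [ae_restrict_mem measurableSet_Ioo] with s hs
    exact Real.rpow_nonneg (by linarith [hs.2]) _
  rw [← ofReal_integral_eq_lintegral_ofReal hint hnn]
  refine ENNReal.ofReal_le_ofReal ?_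
  have heval : ∫ s in Ioo (t' - ρ ^ 2) t', (0 - s) ^ (-(1 / 2) : ℝ) =
      ((0 - t' + ρ ^ 2) ^ (1 / 2 : ℝ) - (0 - t') ^ (1 / 2 : ℝ)) / (1 / 2 : ℝ) := by
    rw [← integral_Ioc_eq_integral_Ioo, ← intervalIntegral.integral_of_le hab,
      intervalIntegral.integral_comp_sub_left (fun x : ℝ => x ^ (-(1 / 2) : ℝ)) 0,
      integral_rpow (Or.inl (by norm_num))]
    congr 1
    · rw [show (0 : ℝ) - (t' - ρ ^ 2) = 0 - t' + ρ ^ 2 by ring]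
      norm_num
    · norm_num
  rw [heval]
  have hα : 0 ≤ 0 - t' := by linarith
  have hsub : (0 - t' + ρ ^ 2) ^ (1 / 2 : ℝ) ≤ (0 - t') ^ (1 / 2 : ℝ) + (ρ ^ 2) ^ (1 / 2 : ℝ) :=
    Real.rpow_add_le_add_rpow hα (by positivity) (by norm_num) (by norm_num)
  have hρ2 : (ρ ^ 2) ^ (1 / 2 : ℝ) = ρ := by
    rw [show ρ ^ 2 = ρ ^ (2 : ℝ) by norm_cast, ← Real.rpow_mul hρ.le]
    norm_num
  rw [div_eq_mul_inv, show ((1 : ℝ) / 2)⁻¹ = 2 by norm_num]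
  nlinarith [hsub, hρ2]

/-- The Frobenius norm squared is continuous in the linear map. [folklore] -/
theorem continuous_frobeniusNormSq₃ : Continuous fun L : ℝ³ →L[ℝ] ℝ³ => frobeniusNormSq L := by
  unfold frobeniusNormSq
  exact continuous_finsetSum _ fun i _ =>
    ((ContinuousLinearMap.apply ℝ ℝ³ _).continuous.norm).pow 2

/-- The gradient integrand is a.e.-measurable on the slab (it is continuous there). [folklore] -/
theorem aemeasurable_frob_apexGradient_slab :
    AEMeasurable (fun q : ℝ × ℝ³ => ENNReal.ofReal (frobeniusNormSq (apexGradient q.1 q.2)))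
      (volume.restrict (Iio (0 : ℝ) ×ˢ (univ : Set ℝ³))) := by
  have hc : ContinuousOn (fun q : ℝ × ℝ³ => fderiv ℝ (apexVelocity q.1) q.2) (Iio (0 : ℝ) ×ˢ univ) :=
    continuousOn_fderiv_slice_of_contDiffOn (contDiffOn_apexVelocity (n := 1)) isOpen_Iio.uniqueDiffOn
  have hc2 : ContinuousOn (fun q : ℝ × ℝ³ => ENNReal.ofReal (frobeniusNormSq (apexGradient q.1 q.2)))
      (Iio (0 : ℝ) ×ˢ univ) :=
    ENNReal.continuous_ofReal.comp_continuousOn (continuous_frobeniusNormSq₃.comp_continuousOn hc)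
  exact hc2.aemeasurable (measurableSet_Iio.prod MeasurableSet.univ)

/-- `E(Q(z,r)) ≤ 768 L² |B₁|` for every admissible cylinder. [folklore] -/
theorem cknE_apex_le {L : ℝ} (hL0 : 0 ≤ L) (hL : ∀ s, |deriv cutoff s| ≤ L) {r : ℝ} (hr : 0 < r)
    {z : ℝ × ℝ³} (hz : parabolicCylinder r z ⊆ Iio (0 : ℝ) ×ˢ (univ : Set ℝ³)) :
    cknE r z apexGradient ≤ ENNReal.ofReal (768 * L ^ 2) * volume (ball (0 : ℝ³) 1) := by
  set V₁ := volume (ball (0 : ℝ³) 1) with hV₁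
  have hz1 : z.1 ≤ 0 := fst_nonpos_of_subset hr hz
  unfold cknE
  have hmeas : AEMeasurable (fun q : ℝ × ℝ³ => ENNReal.ofReal (frobeniusNormSq (apexGradient q.1 q.2)))
      (volume.restrict (parabolicCylinder r z)) :=
    aemeasurable_frob_apexGradient_slab.mono_measure (Measure.restrict_mono hz le_rfl)
  have h1 : ∫⁻ q in parabolicCylinder r z, ENNReal.ofReal (frobeniusNormSq (apexGradient q.1 q.2)) ≤
      ∫⁻ t in Ioo (z.1 - r ^ 2) z.1,
        ENNReal.ofReal (384 * L ^ 2) * V₁ * ENNReal.ofReal ((0 - t) ^ (-(1 / 2) : ℝ)) :=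
    lintegral_cylinder_le_of_slice hmeas (by
      filter_upwards [ae_restrict_mem measurableSet_Ioo] with t ht
      have ht0 : t < 0 := neg_of_mem_time hr hz ht
      refine (sliceE_le hL0 hL ht0 z.2 r).trans (le_of_eq ?_)
      rw [ENNReal.ofReal_mul (by positivity)]
      ring)
  have h2 : ∫⁻ t in Ioo (z.1 - r ^ 2) z.1,
        ENNReal.ofReal (384 * L ^ 2) * V₁ * ENNReal.ofReal ((0 - t) ^ (-(1 / 2) : ℝ)) ≤
      ENNReal.ofReal (384 * L ^ 2) * V₁ * ENNReal.ofReal (2 * r) := by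
    rw [lintegral_const_mul' _ _ (ENNReal.mul_ne_top ENNReal.ofReal_ne_top measure_ball_lt_top.ne)]
    exact mul_le_mul' le_rfl (lintegral_invSqrt_time_le hz1 hr)
  calc (ENNReal.ofReal r)⁻¹ *
        ∫⁻ q in parabolicCylinder r z, ENNReal.ofReal (frobeniusNormSq (apexGradient q.1 q.2))
      ≤ (ENNReal.ofReal r)⁻¹ * (ENNReal.ofReal (384 * L ^ 2) * V₁ * ENNReal.ofReal (2 * r)) :=
        mul_le_mul' le_rfl (h1.trans h2)
    _ = ENNReal.ofReal (768 * L ^ 2) * V₁ := by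
        rw [← ENNReal.ofReal_inv_of_pos hr]
        have e1 : ENNReal.ofReal r⁻¹ * (ENNReal.ofReal (384 * L ^ 2) * V₁ * ENNReal.ofReal (2 * r)) =
            (ENNReal.ofReal r⁻¹ * ENNReal.ofReal (384 * L ^ 2) * ENNReal.ofReal (2 * r)) * V₁ := by
          ring
        have e2 : ENNReal.ofReal r⁻¹ * ENNReal.ofReal (384 * L ^ 2) * ENNReal.ofReal (2 * r) =
            ENNReal.ofReal (r⁻¹ * (384 * L ^ 2) * (2 * r)) := by
          rw [ENNReal.ofReal_mul (by positivity : (0 : ℝ) ≤ r⁻¹ * (384 * L ^ 2)),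
            ENNReal.ofReal_mul (by positivity : (0 : ℝ) ≤ r⁻¹)]
        have e3 : r⁻¹ * (384 * L ^ 2) * (2 * r) = 768 * L ^ 2 := by
          field_simp
          ring
        rw [e1, e2, e3]

/-- **`𝐈(ℝ³ × ℝ₋) < ⊤` for the kinematic witness** (pressure `0`): `A, C ≤ 8|B₁|`, `D = 0`,
`E ≤ 768 L²|B₁|` on every admissible cylinder. [cite: AlbrittonBarker2019, §1] -/
theorem typeIBound_apex_lt_top :
    typeIBound (Iio (0 : ℝ) ×ˢ (univ : Set ℝ³)) apexVelocity 0 apexGradient < ⊤ := by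
  obtain ⟨L, hL0, hL⟩ := exists_bound_deriv_cutoff
  set V₁ := volume (ball (0 : ℝ³) 1) with hV₁
  have hV : V₁ < ⊤ := measure_ball_lt_top
  have hbound : typeIBound (Iio (0 : ℝ) ×ˢ (univ : Set ℝ³)) apexVelocity 0 apexGradient ≤
      8 * V₁ + 8 * V₁ + 0 + ENNReal.ofReal (768 * L ^ 2) * V₁ := by
    refine typeIBound_le_iff.2 fun r hr z hz => ?_
    unfold abScaledSum
    exact add_le_add (add_le_add (add_le_add (cknAEss_apex_le hr hz) (cknC_apex_le hr hz))
      (cknDOsc_zero r z).le) (cknE_apex_le hL0 hL hr hz)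
  refine lt_of_le_of_lt hbound ?_
  have h8 : (8 : ℝ≥0∞) * V₁ < ⊤ := ENNReal.mul_lt_top (by simp) hV
  exact ENNReal.add_lt_top.2 ⟨ENNReal.add_lt_top.2 ⟨ENNReal.add_lt_top.2 ⟨h8, h8⟩, by simp⟩,
    ENNReal.mul_lt_top ENNReal.ofReal_lt_top hV⟩

/-! ### Packaging -/

/-- **The non-PDE conjuncts of the APEX class are jointly satisfiable**: a field, smooth on the
open slab, with a weak spatial gradient there, `𝐈(ℝ³ × ℝ₋) < ⊤` (pressure `0`), the space–time
Type-I bound `‖u‖ ≤ 3/(‖x‖ + √(−t))` and a backward-singular origin. Everything in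
`IsApexProfile` except `IsSuitableWeakSolutionOn` (the Navier–Stokes equations + local energy
inequality) holds. [cite: AlbrittonBarker2019, §1] -/
theorem apexClass_kinematically_inhabited :
    ∃ (C : ℝ) (u : ℝ → ℝ³ → ℝ³) (G : ℝ → ℝ³ → ℝ³ →L[ℝ] ℝ³),
      ContDiffOn ℝ ((⊤ : ℕ∞) : WithTop ℕ∞) (uncurry u) (Iio 0 ×ˢ univ) ∧
      HasWeakSpatialGradientOn 𝕊 u G ∧
      typeIBound (Iio (0 : ℝ) ×ˢ (univ : Set ℝ³)) u 0 G < ⊤ ∧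
      HasTypeIDecay C u ∧ IsBackwardSingularPoint u 0 :=
  ⟨3, apexVelocity, apexGradient, contDiffOn_apexVelocity, apex_hasWeakSpatialGradientOn,
    typeIBound_apex_lt_top, apex_hasTypeIDecay, apex_isBackwardSingularPoint⟩

end ParabolicBump

end Literature.Analysis.FluidPDE
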